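import Summits.CriticalPhenomena.Ising3DConformalLimit.Theorems.PerfectScreeningCoulombImpliesNontrivialGapOfBinder
import Summits.CriticalPhenomena.Ising3DConformalLimit.Theorems.LeeYangGapFirstZeroAntitoneInBeta
import Summits.CriticalPhenomena.Ising3DConformalLimit.Theorems.LeeYangGapMonotonicityTransfer
import Summits.CriticalPhenomena.Ising3DConformalLimit.Theorems.LeeYangGapNewmanFirstZeroBound
import Summits.CriticalPhenomena.Ising3DConformalLimit.Theorems.LeeYangGapGaussianLimitKillsBlockCoupling
import Summits.CriticalPhenomena.Ising3DConformalLimit.Theorems.LeeYangGapAssembly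
import Literature.Barriers.CriticalPhenomena.IsingTrivialityFromDimensionFourWick
import Literature.Probability.LatticeModels.AizenmanWickBoundProofs
import Literature.Probability.LatticeModels.CriticalBlockMoments
import Literature.Barriers.CriticalPhenomena.LongRangeTrivialityOnZ3LayeredAudit

/-!
# If the critical block Binder cumulant tends to zero, every smeared critical field is Gaussian

For the nearest-neighbour Ising model on `ℤ^d`, `d ≥ 3`, critical plus state, block spin
`M_L = ∑_{x ∈ Λ_L} σ_x`, Binder cumulant `g_L = (3⟨M_L²⟩² - ⟨M_L⁴⟩)/⟨M_L²⟩²`: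

* `sum_abs_connectedFour_box_eq` — `∑_{Λ_n⁴} |U₄| = 3⟨M_n²⟩² - ⟨M_n⁴⟩` (Lebowitz: `|U₄| = -U₄`);
* `tendsto_ursellFourSum_zero_of_tendsto_binder` — `g_L → 0` forces Panis's
  `S(μ; L, r) = Σ_L⁻² ∑_{Λ_{rL}⁴} |U₄| = g_{⌊rL⌋} Σ_{⌊rL⌋}²/Σ_L² → 0` for every `r ≥ 1` (variance
  doubling `Σ_{⌊rL⌋} ≤ (2⌈r⌉+3)^{2d} Σ_L`, `integral_sq_sum_box_le`);
* `tendsto_criticalSmearedMGF_one_of_tendsto_binder` — hence every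
  `⟨exp[z T_{f,L} - z²⟨T_{f,L}²⟩/2]⟩_{β_c} → 1` (Aizenman 1982, Prop. 12.1, summed over `n`: the tree
  theorem `tendsto_criticalSmearedMGF_one_of_wickBounds`, with `aizenman_wickDeviation_le_finite_holds`),
  i.e. `HasNonGaussianCriticalSmearing d → ¬ (g_L → 0)`
  (`not_tendsto_binder_of_hasNonGaussianCriticalSmearing`; Aizenman, CDM 2020, Cor. 7.3).

On `ℤ³`: the survey target `HasNonGaussianCriticalSmearing 3` implies crux stmt-CriticalPhenomena-4945
`NearCriticalLeeYangGap` (`stub_gapOfBinderNonvanishing`), and with `MoebiusLimitExists` the conjunct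
`Ising3DConformalLimit` (assembly 4951 with the proved supports 4947–4950).
-/

noncomputable section

namespace Summit.CriticalPhenomena.Ising3DConformalLimit.LeeYangGapSmearedNonGaussianity

open MeasureTheory Filter Topology Finset
open scoped Nat BigOperators
open Literature.Probability.LatticeModels Literature.Probability.Percolation
open Literature.Barriers.CriticalPhenomena

variable {d : ℕ}

/-! ### 1. Sums over `Λ⁴` -/

/-- A sum over `Λ⁴` (as `Fin 4`-tuples) is a fourfold iterated sum (the summand as a function of
the tuple; cf. `LongRangeIsing.sum_piFinset_four`, whose summand is a function of the four entries).
[folklore] -/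
theorem sum_piFinset_four {α M : Type*} [AddCommMonoid M] (s : Finset α) (G : (Fin 4 → α) → M) :
    ∑ u ∈ Fintype.piFinset (fun _ : Fin 4 => s), G u =
      ∑ a ∈ s, ∑ b ∈ s, ∑ c ∈ s, ∑ e ∈ s, G ![a, b, c, e] := by
  rw [LongRangeIsing.sum_piFinset_succ']
  refine Finset.sum_congr rfl fun a _ => ?_
  rw [LongRangeIsing.sum_piFinset_succ']
  refine Finset.sum_congr rfl fun b _ => ?_
  rw [LongRangeIsing.sum_piFinset_succ']
  refine Finset.sum_congr rfl fun c _ => ?_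
  rw [LongRangeIsing.sum_piFinset_succ']
  refine Finset.sum_congr rfl fun e _ => ?_
  rw [Fintype.piFinset_of_isEmpty, Fintype.sum_unique]
  rfl

/-! ### 2. The Ursell four-point sum of the critical state is the Binder numerator -/

/-- `U₄^μ(a,b,c,e)` (`connectedFour`) of a finite measure with the plus correlations at `β_c` is the
lattice Ursell function written with `criticalCorr`. [cite: AizenmanCDM2020, §7 eq. (7.1)] -/
theorem connectedFour_eq_criticalUrsellFour {μ : Measure (SpinConfig (Site d))} [IsFiniteMeasure μ]
    (hμ : ∀ A : Finset (Site d), spinCorr μ A = plusCorr d (criticalBeta d) 0 A) (a b c e : Site d) :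
    connectedFour μ spinAt ![a, b, c, e] =
      criticalCorr d 4 ![a, b, c, e] -
        (criticalCorr d 2 ![a, b] * criticalCorr d 2 ![c, e] +
          criticalCorr d 2 ![a, c] * criticalCorr d 2 ![b, e] +
          criticalCorr d 2 ![a, e] * criticalCorr d 2 ![b, c]) := by
  have h4 : nPoint μ spinAt ![a, b, c, e] = criticalCorr d 4 ![a, b, c, e] := by
    rw [criticalCorr_eq_integral_spinMonomial hμ]
    rfl
  have h2 : ∀ x y : Site d, twoPoint μ spinAt x y = criticalCorr d 2 ![x, y] := fun x y => by
    rw [criticalCorr_eq_integral_spinMonomial hμ, twoPoint]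
    simp [spinMonomial, Fin.prod_univ_two]
  simp only [connectedFour, h4, h2, Matrix.cons_val_zero, Matrix.cons_val_one, Matrix.cons_val]
  ring

/-- **`∑_{Λ_n⁴} |U₄^μ| = 3⟨M_n²⟩² - ⟨M_n⁴⟩`** for a finite measure with the plus correlations at `β_c`
(`d ≥ 3`): by Lebowitz' inequality `|U₄| = -U₄`, and `-∑_{Λ_n⁴} U₄` is the Binder numerator of the
critical block (`three_mul_sq_sub_fourth_eq_neg_sum_ursellFour`).
[cite: Lebowitz1974, Theorem, eq. (2.5b)] [cite: AizenmanCDM2020, §7 eqs. (7.1)–(7.4)] -/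
theorem sum_abs_connectedFour_box_eq (hd : 3 ≤ d) {μ : Measure (SpinConfig (Site d))}
    [IsFiniteMeasure μ] (hμ : ∀ A : Finset (Site d), spinCorr μ A = plusCorr d (criticalBeta d) 0 A)
    (n : ℕ) :
    ∑ p ∈ Fintype.piFinset (fun _ : Fin 4 => box d n), |connectedFour μ spinAt p| =
      3 * (plusExpect d (criticalBeta d) 0 (fun σ => (∑ x ∈ box d n, spinAt x σ) ^ 2)) ^ 2 -
        plusExpect d (criticalBeta d) 0 (fun σ => (∑ x ∈ box d n, spinAt x σ) ^ 4) := by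
  rw [three_mul_sq_sub_fourth_eq_neg_sum_ursellFour d n, sum_piFinset_four,
    ← Finset.sum_neg_distrib]
  refine Finset.sum_congr rfl fun a _ => ?_
  rw [← Finset.sum_neg_distrib]
  refine Finset.sum_congr rfl fun b _ => ?_
  rw [← Finset.sum_neg_distrib]
  refine Finset.sum_congr rfl fun c _ => ?_
  rw [← Finset.sum_neg_distrib]
  refine Finset.sum_congr rfl fun e _ => ?_
  rw [connectedFour_eq_criticalUrsellFour hμ a b c e, abs_of_nonpos]
  simpa using criticalUrsellFour_nonpos hd ![a, b, c, e]

/-! ### 3. `g_L → 0` forces `S(μ; L, r) → 0` and every smeared moment generating function to `1` -/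

/-- **`g_L → 0 ⟹ S(μ; L, r) → 0`** for the DLR state with the plus correlations at `β_c` (`d ≥ 3`)
and every `r ≥ 1`: `S(μ;L,r) = g_n Σ_n²/Σ_L²` with `n = ⌊rL⌋` (`sum_abs_connectedFour_box_eq`) and
`Σ_n ≤ (2⌈r⌉+3)^{2d} Σ_L` (translation invariance, Griffiths I, covering: `integral_sq_sum_box_le`).
[cite: AizenmanCDM2020, §7 Cor. 7.3 and eq. (7.11)] [cite: Panis2023Triviality, proof of Thm. 5.5 (p. 21), S(β,L,f)] -/
theorem tendsto_ursellFourSum_zero_of_tendsto_binder (hd : 3 ≤ d)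
    {μ : Measure (SpinConfig (Site d))} (hμG : μ ∈ isingGibbsMeasures d (criticalBeta d) 0)
    (hTI : IsTranslationInvariantMeasure μ)
    (hμ : ∀ A : Finset (Site d), spinCorr μ A = plusCorr d (criticalBeta d) 0 A)
    (hg : Tendsto (fun L : ℕ =>
      (3 * (plusExpect d (criticalBeta d) 0 (fun σ => (∑ x ∈ box d L, spinAt x σ) ^ 2)) ^ 2 -
          plusExpect d (criticalBeta d) 0 (fun σ => (∑ x ∈ box d L, spinAt x σ) ^ 4)) /
        (plusExpect d (criticalBeta d) 0 (fun σ => (∑ x ∈ box d L, spinAt x σ) ^ 2)) ^ 2)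
      atTop (𝓝 0))
    {r : ℝ} (hr : 1 ≤ r) :
    Tendsto (fun L : ℕ => ursellFourSum μ L r) atTop (𝓝 0) := by
  haveI : IsProbabilityMeasure μ := hμG.1
  have hβ := Literature.Probability.LatticeModels.criticalBeta_nonneg d
  set V : ℕ → ℝ := fun L => plusExpect d (criticalBeta d) 0
    (fun σ => (∑ x ∈ box d L, spinAt x σ) ^ 2) with hV
  set M4 : ℕ → ℝ := fun L => plusExpect d (criticalBeta d) 0
    (fun σ => (∑ x ∈ box d L, spinAt x σ) ^ 4) with hM4
  have hVpos : ∀ n, 0 < V n := fun n => blockVariance_pos (d := d) hβ n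
  have hVint : ∀ n : ℕ, V n = ∫ σ, (∑ x ∈ box d n, spinAt x σ) ^ 2 ∂μ := fun n => by
    have h := blockVariance_eq_blockSpinVariance hβ hμ n
    rw [blockSpinVariance, latticeBox_eq_box (Nat.cast_nonneg n), Nat.floor_natCast] at h
    exact h
  -- Griffiths' first inequality: non-negative pair correlations
  have hG : ∀ x y, 0 ≤ ∫ σ, spinAt x σ * spinAt y σ ∂μ := by
    classical
    intro x y
    by_cases hxy : x = y
    · subst hxy
      simp
    · have hpair : ∀ σ, spinAt x σ * spinAt y σ = spinProduct {x, y} σ := fun σ => by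
        rw [spinProduct, Finset.prod_pair hxy]
      simp_rw [hpair]
      change 0 ≤ spinCorr μ {x, y}
      rw [hμ]
      exact plusCorr_nonneg hβ le_rfl _
  set N : ℝ := ((((2 * (⌈r⌉₊ + 1) + 1) ^ d : ℕ) : ℝ) ^ 2) with hN
  have hr0 : 0 < r := by linarith
  have hn : Tendsto (fun L : ℕ => ⌊r * (L : ℝ)⌋₊) atTop atTop :=
    tendsto_nat_floor_atTop.comp (tendsto_natCast_atTop_atTop.const_mul_atTop hr0)
  have hg' : Tendsto (fun L : ℕ =>
      (3 * V ⌊r * (L : ℝ)⌋₊ ^ 2 - M4 ⌊r * (L : ℝ)⌋₊) / V ⌊r * (L : ℝ)⌋₊ ^ 2 * N ^ 2)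
      atTop (𝓝 0) := by
    have h := (hg.comp hn).mul_const (N ^ 2)
    rw [zero_mul] at h
    exact h
  refine squeeze_zero' (Eventually.of_forall fun L => ursellFourSum_nonneg μ L r) ?_ hg'
  filter_upwards [eventually_ge_atTop 1] with L hL
  set n : ℕ := ⌊r * (L : ℝ)⌋₊ with hn'
  have hnum : ∑ p ∈ Fintype.piFinset (fun _ : Fin 4 => latticeBox d (r * (L : ℝ))),
      |connectedFour μ spinAt p| = 3 * V n ^ 2 - M4 n := by
    rw [latticeBox_eq_box (by positivity)]
    exact sum_abs_connectedFour_box_eq hd hμ n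
  have hden : blockSpinVariance μ (L : ℝ) = V L := (blockVariance_eq_blockSpinVariance hβ hμ L).symm
  have hk : n + L ≤ (⌈r⌉₊ + 1) * (2 * L + 1) := by
    have h := floor_add_floor_le_of_le_mul (M := r * (L : ℝ)) (t := r) (L' := (L : ℝ))
      (by positivity) hr0.le le_rfl
    simpa [Nat.floor_natCast] using h
  have hdoub : V n ≤ N * V L := by
    rw [hVint n, hVint L]
    exact integral_sq_sum_box_le μ hTI hG hk
  have hnum0 : 0 ≤ 3 * V n ^ 2 - M4 n := hnum ▸ Finset.sum_nonneg fun _ _ => abs_nonneg _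
  show ursellFourSum μ L r ≤ (3 * V n ^ 2 - M4 n) / V n ^ 2 * N ^ 2
  rw [ursellFourSum, hnum, hden, div_le_iff₀ (pow_pos (hVpos L) 2)]
  have hVn := hVpos n
  calc 3 * V n ^ 2 - M4 n = (3 * V n ^ 2 - M4 n) / V n ^ 2 * V n ^ 2 := by
        field_simp
    _ ≤ (3 * V n ^ 2 - M4 n) / V n ^ 2 * (N * V L) ^ 2 :=
        mul_le_mul_of_nonneg_left (pow_le_pow_left₀ hVn.le hdoub 2)
          (div_nonneg hnum0 (sq_nonneg _))
    _ = (3 * V n ^ 2 - M4 n) / V n ^ 2 * N ^ 2 * V L ^ 2 := by ring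

/-- **`g_L → 0` ⟹ every `⟨exp[z T_{f,L} - z²⟨T_{f,L}²⟩/2]⟩_{β_c} → 1`** (`d ≥ 3`): Aizenman's
Prop. 12.1 summed over `n` (`tendsto_criticalSmearedMGF_one_of_wickBounds`, fed the theorems
`aizenman_wickDeviation_le_finite_holds`, `exists_freeMeasure_holds`, `m*(β_c) = 0`) together with
`tendsto_ursellFourSum_zero_of_tendsto_binder`. [cite: AizenmanCDM2020, §7 Cor. 7.3] [cite: AizenmanCMP1982, Prop. 12.1] -/
theorem tendsto_criticalSmearedMGF_one_of_tendsto_binder (hd : 3 ≤ d)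
    (hg : Tendsto (fun L : ℕ =>
      (3 * (plusExpect d (criticalBeta d) 0 (fun σ => (∑ x ∈ box d L, spinAt x σ) ^ 2)) ^ 2 -
          plusExpect d (criticalBeta d) 0 (fun σ => (∑ x ∈ box d L, spinAt x σ) ^ 4)) /
        (plusExpect d (criticalBeta d) 0 (fun σ => (∑ x ∈ box d L, spinAt x σ) ^ 2)) ^ 2)
      atTop (𝓝 0))
    {f : EuclideanSpace ℝ (Fin d) → ℝ} (hf : Continuous f) (hfs : HasCompactSupport f) (z : ℝ) :
    Tendsto (fun L : ℕ => criticalSmearedMGF d f L z) atTop (𝓝 1) := by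
  have hβ := Literature.Probability.LatticeModels.criticalBeta_nonneg d
  have hm' : spontaneousMagnetization d (criticalBeta d) = 0 :=
    spontaneousMagnetization_criticalBeta_eq_zero_holds (d := d) hd
  obtain ⟨μ, hμG, hTI, hcorr⟩ := exists_freeMeasure_holds d (β := criticalBeta d) 0 hβ le_rfl
  have hμ : ∀ A, spinCorr μ A = plusCorr d (criticalBeta d) 0 A := fun A =>
    (hcorr A).trans (freeCorr_eq_plusCorr_of_spontaneousMagnetization_eq_zero hβ hm' A)
  have hodd : ∀ {n : ℕ}, Odd n → ∀ x : Fin n → Site d, ∫ σ, ∏ i, spinAt (x i) σ ∂μ = 0 :=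
    fun hn x => integral_prod_spinAt_eq_zero_of_freeCorr hβ hcorr hn x
  obtain ⟨hlow, hW⟩ := pairingLowerBound_and_wickDeviationBound_of_freeCorr
    aizenman_wickDeviation_le_finite_holds hβ hcorr
  exact tendsto_criticalSmearedMGF_one_of_wickBounds hμG hTI hμ hlow hW hodd
    (fun r hr => tendsto_ursellFourSum_zero_of_tendsto_binder hd hμG hTI hμ hg hr) hf hfs z

/-- **A non-Gaussian smeared critical field forbids `g_L → 0`** (`d ≥ 3`):
`HasNonGaussianCriticalSmearing d → ¬ (g_L → 0)`, i.e. `limsup_L g_L > 0` (as `0 ≤ g_L ≤ 2`).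
[cite: AizenmanCDM2020, §7 Cor. 7.3] [cite: AizenmanDuminilCopinAnnals2021, Prop. 1.4] -/
theorem not_tendsto_binder_of_hasNonGaussianCriticalSmearing (hd : 3 ≤ d)
    (h : HasNonGaussianCriticalSmearing d) :
    ¬ Tendsto (fun L : ℕ =>
      (3 * (plusExpect d (criticalBeta d) 0 (fun σ => (∑ x ∈ box d L, spinAt x σ) ^ 2)) ^ 2 -
          plusExpect d (criticalBeta d) 0 (fun σ => (∑ x ∈ box d L, spinAt x σ) ^ 4)) /
        (plusExpect d (criticalBeta d) 0 (fun σ => (∑ x ∈ box d L, spinAt x σ) ^ 2)) ^ 2)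
      atTop (𝓝 0) := fun hg => by
  obtain ⟨f, hf, hfs, z, -, hnot⟩ := h
  exact hnot (tendsto_criticalSmearedMGF_one_of_tendsto_binder hd hg hf hfs z)

/-! ### 4. `ℤ³`: the survey target implies crux 4945, and the conjunct given the Möbius limit -/

/-- **The survey target I-1 ⟹ crux 4945**: `HasNonGaussianCriticalSmearing 3 → NearCriticalLeeYangGap`
(through `¬ (g_L → 0)` and the landed `stub_gapOfBinderNonvanishing` of line SketchPub, crux 13885).
[cite: Newman1975, Thm 3] [cite: AizenmanCDM2020, §7 Cor. 7.3] -/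
theorem nearCriticalLeeYangGap_of_hasNonGaussianCriticalSmearing_three
    (h : HasNonGaussianCriticalSmearing 3) :
    Summit.CriticalPhenomena.Ising3DConformalLimit.Theses.LeeYangGap.NearCriticalLeeYangGap :=
  PerfectScreeningCoulombImpliesNontrivial.stub_gapOfBinderNonvanishing
    (not_tendsto_binder_of_hasNonGaussianCriticalSmearing (by norm_num) h)

/-- **Smeared non-Gaussianity plus the Möbius-covariant limit give the conjunct**:
`HasNonGaussianCriticalSmearing 3 → MoebiusLimitExists → Ising3DConformalLimit` (route LeeYangGap's
assembly 4951 with the proved supports 4947–4950). [cite: AizenmanDuminilCopinAnnals2021, Prop. 1.4] -/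
theorem ising3DConformalLimit_of_hasNonGaussianCriticalSmearing_three
    (h : HasNonGaussianCriticalSmearing 3)
    (hM : Summit.CriticalPhenomena.Ising3DConformalLimit.Theses.LeeYangGap.MoebiusLimitExists) :
    Ising3DConformalLimit :=
  Theorems.leeYangGap_assembly_proof (nearCriticalLeeYangGap_of_hasNonGaussianCriticalSmearing_three h)
    Theorems.firstZeroAntitoneInBeta_proof Theorems.monotonicityTransfer_proof
    LeeYangGapNewmanFirstZeroBound.newmanFirstZeroBound_proof
    LeeYangGapGaussianLimitKillsBlockCoupling.gaussianLimitKillsBlockCoupling_proof hM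

end Summit.CriticalPhenomena.Ising3DConformalLimit.LeeYangGapSmearedNonGaussianity

end
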